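import Literature.AlgebraicGeometry.RelativeSpec.GeometricQuotientBaseChange
import Literature.AlgebraicGeometry.Motives.FiniteQuotient
import Literature.AlgebraicGeometry.Motives.BaseChange
import Literature.AlgebraicGeometry.Motives.TorsorCoproductQuotient
import HarnessLib

/-!
# Finite-group quotients of projective schemes commute with extension of the base field
# (SGA 1, Exp. V, Prop. 1.9; Mumford, *Abelian Varieties*, §7, Theorem p. 66)

Topic `AlgebraicGeometry/Motives`; namespace `Literature.AlgebraicGeometry.Motives`. For a field `L`, an
embedding `τ : L →+* ℂ`, a finite group `Δ` acting on a PROJECTIVE `L`-scheme `Y` by `L`-automorphisms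
(`act : Δ →* Aut Y`) and a quotient `p : Y ⟶ Z` of `Y` by `Δ` for separated test objects
(`Motives.IsSepQuotient`, `Z` separated over `L`), the base change `p ⊗_{L,τ} ℂ` is a quotient of `Y ⊗ ℂ`
by `Δ` for separated test objects and `Z ⊗ ℂ` is separated
(`isSepQuotient_baseChangeHom_of_isProjectiveOver`; SGA 1 V 1.9 «la formation du quotient commute au
changement de base plat» for the flat base change `Spec ℂ → Spec L`). This is the statement
`StubQuotientBaseChange` of the crux line `HeckeQuotient` (binder `HypDel`, cell `hodgecm-mathlib`), with its
binders verbatim.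

Proof. (1) `Z ≅ Y/Δ := Motives.finiteQuotient ρ` under `Y` by the two universal properties
(`isoFiniteQuotient_of_isSepQuotient`; orbits lie in affine opens because `Y` is projective,
`forall_exists_stableAffineOpen_of_isProjectiveOver`), and `IsSepQuotient` is insensitive to isomorphisms of the
target (`IsSepQuotient.of_comp_iso`). (2) The quotient map `π : Y → Y/Δ` is an affine GEOMETRIC quotient
(Mumford's (1), (2): `RelativeSpec.ActionOver.isGeometricQuotient_gluedMk`), geometric quotients commute with
extension of the base field (`RelativeSpec.ActionOver.isGeometricQuotient_baseChange`), and a geometric quotient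
is a categorical quotient for separated targets (`IsGeometricQuotient.existsUnique_desc`), which in the `Over`
category is `IsSepQuotient` (`isSepQuotient_of_isGeometricQuotient`). (3) Separatedness is stable under base
change (Mathlib).

* `actionOver_aut_hom` bookkeeping: the `RelativeSpec.ActionOver` on `Y.left` attached to `act : Δ →* Aut Y`
  is written inline as `⟨((Over.forget _).mapAut Y).comp act, _⟩` (no definition is introduced);
* `isSepQuotient_of_isGeometricQuotient`, `IsSepQuotient.of_comp_iso`, `isoFiniteQuotient_of_isSepQuotient`;
* `isSepQuotient_baseChangeHom_of_isProjectiveOver` — the theorem.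

Everything is proved; no named facts and no definitions.

Mathlib searched (pin): `Functor.mapAut`, `Over.pullback` (`Over.w`, `Over.homMk`, `Over.OverMorphism.ext`),
`MorphismProperty.pullback_snd` for `@IsSeparated` (all used).

## References
* [SGA1] A. Grothendieck, *SGA 1*, Exp. V, §1, Prop. 1.9.
* [MumfordAV1970] D. Mumford, *Abelian Varieties* (1970), §7 Theorem p. 66 and Remark.
* [Deligne1971TravauxShimura] P. Deligne, *Travaux de Shimura*, Sém. Bourbaki 389 (1971), (5.11.1) (the use).
-/

noncomputable section

open CategoryTheory CategoryTheory.Limits AlgebraicGeometry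
open Literature.AlgebraicGeometry.RelativeSpec

namespace Literature.AlgebraicGeometry.Motives

universe u v

/-! ### From geometric quotients (schemes) to separated quotients (`k`-schemes) -/

section OverCategory

variable {k : Type u} [Field k] {Δ : Type v} {Y Z : SchemeOver k}

/-- A `k`-scheme with separated structure map is a separated scheme. [folklore] -/
private theorem isSeparated_left_of_isSeparated_hom (W : SchemeOver k) (hW : IsSeparated W.hom) :
    W.left.IsSeparated :=
  ⟨by rw [← terminal.comp_from W.hom]; infer_instance⟩

/-- **A geometric quotient is a separated quotient.** If the underlying morphism of schemes of a `k`-morphism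
`p : Y ⟶ Z` is a geometric quotient (Mumford's (1), (2)) for an action whose automorphisms are the
`k`-automorphisms `act g`, then `p` is a quotient of `Y` by the `act g` for separated test objects in the category of
`k`-schemes (Mumford's Remark: a geometric quotient is a categorical quotient; the descended morphism is
automatically over `k`, by uniqueness against the separated `Spec k`). [cite: MumfordAV1970, §7 Thm. p. 66 (Remark)] -/
theorem isSepQuotient_of_isGeometricQuotient (act : Δ → (Y ≅ Y)) (p : Y ⟶ Z) {S : Scheme.{u}}
    {r : Y.left ⟶ S} {G : Type*} [Group G] (ρ : ActionOver r G) (e : Δ → G) (e' : G → Δ)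
    (hρ : ∀ g : G, (ρ.aut g).hom = (act (e' g)).hom.left) (hρ' : ∀ d : Δ, (act d).hom.left = (ρ.aut (e d)).hom)
    (h : ρ.IsGeometricQuotient p.left) : IsSepQuotient act p := by
  refine ⟨fun d => Over.OverMorphism.ext ?_, fun W f hW hf => ?_⟩
  · rw [Over.comp_left, hρ']
    exact h.comp_eq (e d)
  · haveI := isSeparated_left_of_isSeparated_hom W hW
    have hf' : ∀ g : G, (ρ.aut g).hom ≫ f.left = f.left := fun g => by
      rw [hρ g, ← Over.comp_left, hf]
    obtain ⟨fb, hfb, huniq⟩ := h.existsUnique_desc f.left hf'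
    have hover : fb ≫ W.hom = Z.hom := by
      haveI : (Spec (CommRingCat.of k)).IsSeparated := inferInstance
      apply h.desc_unique
      rw [reassoc_of% hfb, Over.w f, ← Over.w p]
    refine ⟨Over.homMk fb hover, Over.OverMorphism.ext (by exact hfb), fun c hc => Over.OverMorphism.ext ?_⟩
    have hc : p ≫ c = f := hc
    change c.left = fb
    exact huniq c.left (by change p.left ≫ c.left = f.left; rw [← Over.comp_left, hc])

/-- `IsSepQuotient` is insensitive to isomorphisms of the target: if `p ≫ i` is a separated quotient for an
isomorphism `i`, so is `p`. [cite: MumfordAV1970, §7 Thm. p. 66 (Remark)] -/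
theorem IsSepQuotient.of_comp_iso {act : Δ → (Y ≅ Y)} {p : Y ⟶ Z} {Z' : SchemeOver k} (i : Z ≅ Z')
    (h : IsSepQuotient act (p ≫ i.hom)) : IsSepQuotient act p := by
  refine ⟨fun g => ?_, fun W f hW hf => ?_⟩
  · rw [← cancel_mono i.hom, Category.assoc, h.hom_comp g]
  · obtain ⟨fb, hfb⟩ := (h.existsUnique f hW hf).exists
    refine ⟨i.hom ≫ fb, ?_, fun c hc => ?_⟩
    · change p ≫ i.hom ≫ fb = f
      rw [← Category.assoc]
      exact hfb
    · change p ≫ c = f at hc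
      have hu := (h.existsUnique f hW hf).unique (y₁ := i.inv ≫ c) (y₂ := fb)
        (by rw [Category.assoc, i.hom_inv_id_assoc, hc]) hfb
      rw [← hu, i.hom_inv_id_assoc]

end OverCategory

/-! ### A separated quotient of a projective scheme is the tree's `finiteQuotient` -/

section FiniteQuotient

variable {k : Type u} [Field k] {Δ : Type} [Group Δ] [Finite Δ] {Y Z : SchemeOver k}

/-- **Uniqueness of the separated quotient**: if `p : Y ⟶ Z` is a quotient of the projective `k`-scheme `Y` by the
finite group `Δ ≤ Aut_k(Y)` for separated test objects and `Z` is separated, then `Z ≅ Y/Δ` under `Y`, where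
`Y/Δ = Motives.finiteQuotient` is Mumford's quotient (the two universal properties, `finiteQuotient.desc` /
`desc_unique` and `IsSepQuotient`). [cite: MumfordAV1970, §7 Thm. p. 66 (Remark)] -/
theorem isoFiniteQuotient_of_isSepQuotient (hY : IsProjectiveOver Y) (act : Δ →* Aut Y) (p : Y ⟶ Z)
    (hZ : IsSeparated Z.hom) (hq : IsSepQuotient (fun g => act g) p) :
    letI : IsSeparated Y.hom := by haveI := hY.isProper; infer_instance
    ∃ i : Z ≅ finiteQuotient (⟨((Over.forget _).mapAut Y).comp act, fun g => Over.w (act g).hom⟩ :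
        ActionOver Y.hom Δ),
      p ≫ i.hom = finiteQuotient.mk _
        (ActionOver.forall_exists_stableAffineOpen_of_isProjectiveOver _ hY) := by
  haveI : IsSeparated Y.hom := by haveI := hY.isProper; infer_instance
  let ρ : ActionOver Y.hom Δ := ⟨((Over.forget _).mapAut Y).comp act, fun g => Over.w (act g).hom⟩
  have hcov := ActionOver.forall_exists_stableAffineOpen_of_isProjectiveOver ρ hY
  have hov : ∀ g : Δ, (ρ.overIso g).hom = (act g).hom := fun g => Over.OverMorphism.ext rfl
  have hπ : ∀ g : Δ, (act g).hom ≫ finiteQuotient.mk ρ hcov = finiteQuotient.mk ρ hcov := fun g => by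
    rw [← hov]; exact finiteQuotient.overIso_hom_mk ρ hcov g
  have hp : ∀ g : Δ, (ρ.overIso g).hom ≫ p = p := fun g => by rw [hov]; exact hq.hom_comp g
  haveI : Z.left.IsSeparated := isSeparated_left_of_isSeparated_hom Z hZ
  haveI : (finiteQuotient ρ).left.IsSeparated :=
    isSeparated_left_of_isSeparated_hom _ (isSeparated_finiteQuotient_hom ρ hcov)
  obtain ⟨a, ha, -⟩ := hq.existsUnique (finiteQuotient.mk ρ hcov) (isSeparated_finiteQuotient_hom ρ hcov) hπ
  let b : finiteQuotient ρ ⟶ Z := finiteQuotient.desc ρ hcov p hp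
  have hab : a ≫ b = 𝟙 Z := hq.hom_ext hZ (by rw [reassoc_of% ha, finiteQuotient.mk_desc, Category.comp_id])
  have hba : b ≫ a = 𝟙 _ := by
    rw [finiteQuotient.desc_unique ρ hcov (finiteQuotient.mk ρ hcov) hπ (b ≫ a)
        (by rw [← Category.assoc, finiteQuotient.mk_desc, ha]),
      finiteQuotient.desc_unique ρ hcov (finiteQuotient.mk ρ hcov) hπ (𝟙 _) (Category.comp_id _)]
  exact ⟨⟨a, b, hab, hba⟩, ha⟩

end FiniteQuotient

/-! ### The theorem -/

set_option maxHeartbeats 400000 in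
/-- **Finite-group quotients commute with base change to `ℂ`** (SGA 1, Exp. V, Prop. 1.9 for the flat base change
`Spec ℂ → Spec L`; Mumford, AV §7 Thm. p. 66). Let `L` be a field, `τ : L →+* ℂ`, `Δ` a finite group acting on the
PROJECTIVE `L`-scheme `Y` by `L`-automorphisms, and `p : Y ⟶ Z` a quotient of `Y` by `Δ` for separated test objects
with `Z` separated over `L`. Then `Z ⊗_{L,τ} ℂ` is separated over `ℂ` and `p ⊗_{L,τ} ℂ` is a quotient of `Y ⊗_{L,τ} ℂ`
by the base-changed action for separated test objects. (Affine-locally: `(A^Δ) ⊗_L ℂ = (A ⊗_L ℂ)^Δ`, since `ℂ` is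
flat over `L`; globally: `Z ≅ Y/Δ`, the quotient map is an affine geometric quotient, geometric quotients commute
with extension of the base field and are categorical quotients.) This is `StubQuotientBaseChange` of the crux line
`HeckeQuotient` for `HypDel`, binders verbatim. [cite: SGA1, Exp. V Prop. 1.9] [cite: MumfordAV1970, §7 Thm. p. 66] -/
theorem isSepQuotient_baseChangeHom_of_isProjectiveOver (L : Type) [Field L] (τ : L →+* ℂ) (Δ : Type)
    [Group Δ] [Fintype Δ] (Y Z : SchemeOver L) (hY : IsProjectiveOver Y) (act : Δ →* Aut Y) (p : Y ⟶ Z)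
    (hZ : IsSeparated Z.hom) (hq : IsSepQuotient (fun g => act g) p) :
    IsSeparated ((Motives.baseChangeHom τ).obj Z).hom ∧
      IsSepQuotient (fun g => (Motives.baseChangeHom τ).mapIso (act g)) ((Motives.baseChangeHom τ).map p) := by
  refine ⟨?_, ?_⟩
  · -- separatedness is stable under base change
    haveI := hZ
    change IsSeparated (pullback.snd Z.hom (Spec.map (CommRingCat.ofHom τ)))
    infer_instance
  -- (1) `Z ≅ Y/Δ`
  haveI : IsSeparated Y.hom := by haveI := hY.isProper; infer_instance
  let ρ : ActionOver Y.hom Δ := ⟨((Over.forget _).mapAut Y).comp act, fun g => Over.w (act g).hom⟩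
  have hcov := ActionOver.forall_exists_stableAffineOpen_of_isProjectiveOver ρ hY
  obtain ⟨i, hi⟩ := isoFiniteQuotient_of_isSepQuotient hY act p hZ hq
  refine IsSepQuotient.of_comp_iso ((Motives.baseChangeHom τ).mapIso i) ?_
  rw [Functor.mapIso_hom, ← Functor.map_comp, hi]
  -- (2) the quotient map `π : Y → Y/Δ` is an affine geometric quotient, and so is its base change
  have hgq : ρ.IsGeometricQuotient (finiteQuotient.mk ρ hcov).left := ρ.isGeometricQuotient_gluedMk hcov
  haveI : IsAffineHom (finiteQuotient.mk ρ hcov).left := finiteQuotient.isAffineHom_mk_left ρ hcov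
  let act' : Δ →* Aut ((Motives.baseChangeHom τ).obj Y) := ((Motives.baseChangeHom τ).mapAut Y).comp act
  let ρ' : ActionOver ((Motives.baseChangeHom τ).obj Y).hom Δ :=
    ⟨((Over.forget _).mapAut _).comp act', fun g => Over.w (act' g).hom⟩
  have hρ' : ∀ g : Δ, (ρ'.aut g).hom ≫ pullback.fst Y.hom (Spec.map (CommRingCat.ofHom τ)) =
      pullback.fst Y.hom (Spec.map (CommRingCat.ofHom τ)) ≫ (ρ.aut g).hom := fun g =>
    baseChangeHom_map_left_comp_fst τ (act g).hom
  have hgq' : ρ'.IsGeometricQuotient ((Motives.baseChangeHom τ).map (finiteQuotient.mk ρ hcov)).left :=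
    ρ.isGeometricQuotient_baseChange τ (Over.w (finiteQuotient.mk ρ hcov)) hgq ρ' hρ' _
      (baseChangeHom_map_left_comp_fst τ (finiteQuotient.mk ρ hcov))
      (Over.w ((Motives.baseChangeHom τ).map (finiteQuotient.mk ρ hcov)))
  -- (3) a geometric quotient is a separated quotient
  exact isSepQuotient_of_isGeometricQuotient _ _ ρ' id id (fun g => rfl) (fun g => rfl) hgq'

end Literature.AlgebraicGeometry.Motives

end
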